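/-
Cell b2b-lgcu-borel (gen 20).  VALUE = THEOREM (laws constraining hypothetical witnesses of the crux),
NOT summit progress; the crux item `SubgroupIdentityDesigns` (stmt-MatrixMultiplication-14079) stays open.
-/
import Mathlib
import Summits.MatrixMultiplication.MatrixMultiplication.Theorems.SubgroupIdentityDesigns.Negative.LevelOneInvariantDim
import Summits.MatrixMultiplication.MatrixMultiplication.Theorems.SubgroupIdentityDesigns.Negative.LevelOneFloorAll

/-!
# The semiregular law for level-one witnesses (every dimension `m`)

Route `LevelGradedCohnUmans`, crux `SubgroupIdentityDesigns` (stmt-MatrixMultiplication-14079), cells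
`(m, k) = (m, 1)`; report `run/shared/lean/b2b/levelgraded-cu/ORACLE-g20.md` §G20-3.  VALUE = THEOREM
(a new law, independent of the two graded Neumann counts of `WitnessNeumannCounts`), NOT summit
progress; the crux item is untouched and remains open.

Write `x, y, z = |H₁|, |H₂|, |H₃|`, `b = #ℙ^{m-1}(𝔽_p) = (p^m − 1)/(p − 1)`, and call a subgroup
`K ≤ GL_m(𝔽_p)` SEMIREGULAR if no `k ≠ 1` of `K` fixes a non-zero vector (hypothesis `hsr`; e.g.
scalar subgroups, subgroups of Singer cycles).  For a hypothetical level-one witness (`SubgroupTPP` + an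
identity design of level `1`):

* `law_right` / `crux_law_right` — **`(x + y − 1)·z + |K|·(b − 1) ≤ (p − 1)·b²`** for every semiregular
  `K ≤ H₃`: the free-module law `(x + y − 1) z ≤ |K| · dim (F_1)^K` (`FreeModuleLaw`) combined with
  the orbit-count evaluation `|K| · dim (F_1)^K + |K|(b − 1) ≤ (p − 1) b²` (`LevelOneInvariantDim`).
  Compare the Neumann count `(x + y − 1) z ≤ dim F_1 = (p − 1) b² − 2b + 2`: a semiregular subgroup of
  order `n` inside the third member LOWERS the ceiling by `n (b − 1) − 2 (b − 1)`.
* `law_left` / `crux_law_left` — the same with `H₁` and `H₃` exchanged, by REVERSAL in every dimension: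
  `tpp_reverse`, `comp_inv_mem` (`F_1|_G` is inversion-stable for all `m`; the tree had `m = 2` only,
  `Reversal`), `test_reverse`.
* `no_biSemiregular_3_11` — a decidable verdict using the new law where the Neumann squeeze
  (`LevelOneNeumannSqueeze`, `ε ≤ ε_N(11) ≈ 0.684`) is silent: at `(m, p) = (3, 11)` and EVERY
  `−2 < ε ≤ 1` there is no witness whose end members `H₁`, `H₃` are both semiregular
  (laws: `z (x + y + 131) ≤ 176890`, `x (z + y + 131) ≤ 176890`; floor `xyz ≥ 23 473 703`
  (`LevelOneFloorAll`); but the laws force `xyz ≤ 176890 u − u³ − 131 u² ≤ 22 144 864`, `u = min (x, z)`).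

Sorry-free; standard axioms.
-/

set_option linter.dupNamespace false

noncomputable section

open scoped BigOperators Classical Matrix LinearAlgebra.Projectivization
open Module (finrank)

namespace Summit.MatrixMultiplication.MatrixMultiplication.Theorems.SubgroupIdentityDesigns.Negative
namespace SemiregularLaw

open Summit.MatrixMultiplication.MatrixMultiplication.Theorems.LieRankDesigns.Negative (GLm Mat budget)
open Summit.MatrixMultiplication.MatrixMultiplication.Theorems.LevelOneGL2Designs.Negative
  (levelSubmodule levelSubmodule_bi_inv)
open Literature.Barriers.MatrixMultiplication (SubgroupTPP)
open VectorTransportSpan (levelSubmodule_le_of_transport mul_col_eq_iff)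
open FreeModuleLaw (invRight card_mul_le_card_mul_finrank_invRight)
open LevelOneInvariantDim (card_mul_finrank_le_of_semiregular)
open LineStabilizer (mulVec_eq_iff)
open PackingBridge (exists_test)

variable {p m : ℕ} [hp : Fact p.Prime]

/-! ## Reversal in every dimension -/

/-- The subgroup TPP is invariant under `(H₁, H₂, H₃) ↦ (H₃, H₂, H₁)` (any group). -/
theorem tpp_reverse {G : Type*} [Group G] {H₁ H₂ H₃ : Subgroup G} (h : SubgroupTPP H₁ H₂ H₃) :
    SubgroupTPP H₃ H₂ H₁ := by
  intro c hc b hb a ha habc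
  have h1 : a⁻¹ * b⁻¹ * c⁻¹ = 1 := by
    rw [← mul_inv_rev, ← mul_inv_rev, ← mul_assoc, habc, inv_one]
  obtain ⟨ha1, hb1, hc1⟩ := h a⁻¹ (H₁.inv_mem ha) b⁻¹ (H₂.inv_mem hb) c⁻¹ (H₃.inv_mem hc) h1
  exact ⟨inv_eq_one.mp hc1, inv_eq_one.mp hb1, inv_eq_one.mp ha1⟩

/-- An identity test reverses with the triple: `g ↦ f g⁻¹` vanishes on `H₃ H₂ H₁ ∖ 1`. -/
theorem test_reverse {G : Type*} [Group G] {H₁ H₂ H₃ : Subgroup G} {f : G → ℂ}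
    (h0 : ∀ a ∈ H₁, ∀ b ∈ H₂, ∀ c ∈ H₃, a * b * c ≠ 1 → f (a * b * c) = 0) :
    ∀ c ∈ H₃, ∀ b ∈ H₂, ∀ a ∈ H₁, c * b * a ≠ 1 → (fun g : G => f g⁻¹) (c * b * a) = 0 := by
  intro c hc b hb a ha hne
  have hrev : (c * b * a)⁻¹ = a⁻¹ * b⁻¹ * c⁻¹ := by rw [mul_inv_rev, mul_inv_rev, mul_assoc]
  show f (c * b * a)⁻¹ = 0
  rw [hrev]
  refine h0 _ (H₁.inv_mem ha) _ (H₂.inv_mem hb) _ (H₃.inv_mem hc) ?_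
  rw [← hrev]
  exact inv_ne_one.mpr hne

/-- Vector transports are level-one functions: `g ↦ [g u = a] ∈ F_1|_G` (`FrameGhost.transport_mem`
for `m × 1` frames). -/
theorem vecTransport_mem (u a : Fin m → ZMod p) :
    (fun g : GLm p m => if (g : Mat p m) *ᵥ u = a then (1 : ℂ) else 0) ∈ levelSubmodule p m 1 := by
  have h := FrameGhost.transport_mem (p := p) (k := 1) (Matrix.of fun i (_ : Fin 1) => u i)
    (Matrix.of fun i (_ : Fin 1) => a i)
  have hiff : ∀ g : GLm p m, (g : Mat p m) * Matrix.of (fun i (_ : Fin 1) => u i) =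
      Matrix.of (fun i (_ : Fin 1) => a i) ↔ (g : Mat p m) *ᵥ u = a := fun g => by
    rw [mul_col_eq_iff]; exact Iff.rfl
  simp only [hiff] at h
  exact h

/-- The inversion `f ↦ (g ↦ f g⁻¹)` as a linear map. -/
def precompInv : (GLm p m → ℂ) →ₗ[ℂ] (GLm p m → ℂ) where
  toFun f g := f g⁻¹
  map_add' _ _ := rfl
  map_smul' _ _ := rfl

/-- **`F_1|_G` is inversion-stable in every dimension**: `f ∈ F_1 ⟹ (g ↦ f g⁻¹) ∈ F_1`
(`[g⁻¹ u = a] = [g a = u]` on the spanning transports). -/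
theorem comp_inv_mem {f : GLm p m → ℂ} (hf : f ∈ levelSubmodule p m 1) :
    (fun g : GLm p m => f g⁻¹) ∈ levelSubmodule p m 1 := by
  have hle : levelSubmodule p m 1 ≤
      (levelSubmodule p m 1).comap (precompInv (p := p) (m := m)) := by
    refine levelSubmodule_le_of_transport fun u a => ?_
    rw [Submodule.mem_comap]
    have : precompInv (fun g : GLm p m => if (g : Mat p m) *ᵥ u = a then (1 : ℂ) else 0) =
        fun g : GLm p m => if (g : Mat p m) *ᵥ a = u then (1 : ℂ) else 0 := by
      funext g
      show (if ((g⁻¹ : GLm p m) : Mat p m) *ᵥ u = a then (1 : ℂ) else 0) = _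
      have hiff : ((g⁻¹ : GLm p m) : Mat p m) *ᵥ u = a ↔ (g : Mat p m) *ᵥ a = u := by
        rw [mulVec_eq_iff, inv_inv, eq_comm]
      simp only [hiff]
    rw [this]
    exact vecTransport_mem a u
  have h := hle hf
  rw [Submodule.mem_comap] at h
  exact h

/-! ## The semiregular laws -/

/-- **SEMIREGULAR LAW (third member), test form.**  TPP, a level-one identity test `f`, and a
semiregular `K ≤ H₃`: `(x + y − 1) z + |K| (b − 1) ≤ (p − 1) b²`. -/
theorem law_right (hm : 1 ≤ m) {H₁ H₂ H₃ : Subgroup (GLm p m)} (htpp : SubgroupTPP H₁ H₂ H₃)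
    {f : GLm p m → ℂ} (hf : f ∈ levelSubmodule p m 1) (h1 : f 1 = 1)
    (h0 : ∀ a ∈ H₁, ∀ b ∈ H₂, ∀ c ∈ H₃, a * b * c ≠ 1 → f (a * b * c) = 0)
    {K : Subgroup (GLm p m)} (hK : K ≤ H₃)
    (hsr : ∀ k : K, ∀ v : Fin m → ZMod p, v ≠ 0 → k • v = v → k = 1) :
    (Nat.card H₁ + (Nat.card H₂ - 1)) * Nat.card H₃ +
        Nat.card K * (Nat.card (ℙ (ZMod p) (Fin m → ZMod p)) - 1) ≤
      (p - 1) * Nat.card (ℙ (ZMod p) (Fin m → ZMod p)) ^ 2 := by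
  have hA := card_mul_le_card_mul_finrank_invRight (levelSubmodule p m 1) levelSubmodule_bi_inv htpp
    hf h1 h0 hK
  have hB := card_mul_finrank_le_of_semiregular hm K hsr
  omega

/-- **SEMIREGULAR LAW (first member), test form**, by reversal: semiregular `K ≤ H₁` gives
`(z + y − 1) x + |K| (b − 1) ≤ (p − 1) b²`. -/
theorem law_left (hm : 1 ≤ m) {H₁ H₂ H₃ : Subgroup (GLm p m)} (htpp : SubgroupTPP H₁ H₂ H₃)
    {f : GLm p m → ℂ} (hf : f ∈ levelSubmodule p m 1) (h1 : f 1 = 1)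
    (h0 : ∀ a ∈ H₁, ∀ b ∈ H₂, ∀ c ∈ H₃, a * b * c ≠ 1 → f (a * b * c) = 0)
    {K : Subgroup (GLm p m)} (hK : K ≤ H₁)
    (hsr : ∀ k : K, ∀ v : Fin m → ZMod p, v ≠ 0 → k • v = v → k = 1) :
    (Nat.card H₃ + (Nat.card H₂ - 1)) * Nat.card H₁ +
        Nat.card K * (Nat.card (ℙ (ZMod p) (Fin m → ZMod p)) - 1) ≤
      (p - 1) * Nat.card (ℙ (ZMod p) (Fin m → ZMod p)) ^ 2 :=
  law_right hm (tpp_reverse htpp) (comp_inv_mem hf) (by simp only [inv_one]; exact h1)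
    (test_reverse h0) hK hsr

section Crux

variable {H₁ H₂ H₃ : Subgroup (GLm p m)}

/-- **SEMIREGULAR LAW (third member), crux form**: hypotheses exactly those of a witness of
`SubgroupIdentityDesigns` at level `k = 1` (any `ε`), plus a semiregular `K ≤ H₃`. -/
theorem crux_law_right (hm : 1 ≤ m) (htpp : SubgroupTPP H₁ H₂ H₃)
    (hdes : ∃ c : Mat p m → ℂ, (∀ M, 1 < M.rank → c M = 0) ∧
      (∑ M, c M * ZMod.stdAddChar (Matrix.trace (M * ((1 : GLm p m) : Mat p m)))) = 1 ∧
      ∀ a ∈ H₁, ∀ b ∈ H₂, ∀ g ∈ H₃, a * b * g ≠ 1 →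
        (∑ M, c M * ZMod.stdAddChar (Matrix.trace (M * ((a * b * g : GLm p m) : Mat p m)))) = 0)
    {K : Subgroup (GLm p m)} (hK : K ≤ H₃)
    (hsr : ∀ k : K, ∀ v : Fin m → ZMod p, v ≠ 0 → k • v = v → k = 1) :
    (Nat.card H₁ + (Nat.card H₂ - 1)) * Nat.card H₃ +
        Nat.card K * (Nat.card (ℙ (ZMod p) (Fin m → ZMod p)) - 1) ≤
      (p - 1) * Nat.card (ℙ (ZMod p) (Fin m → ZMod p)) ^ 2 := by
  obtain ⟨f, hf, h1, h0⟩ := exists_test hdes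
  exact law_right hm htpp hf h1 h0 hK hsr

/-- **SEMIREGULAR LAW (first member), crux form.** -/
theorem crux_law_left (hm : 1 ≤ m) (htpp : SubgroupTPP H₁ H₂ H₃)
    (hdes : ∃ c : Mat p m → ℂ, (∀ M, 1 < M.rank → c M = 0) ∧
      (∑ M, c M * ZMod.stdAddChar (Matrix.trace (M * ((1 : GLm p m) : Mat p m)))) = 1 ∧
      ∀ a ∈ H₁, ∀ b ∈ H₂, ∀ g ∈ H₃, a * b * g ≠ 1 →
        (∑ M, c M * ZMod.stdAddChar (Matrix.trace (M * ((a * b * g : GLm p m) : Mat p m)))) = 0)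
    {K : Subgroup (GLm p m)} (hK : K ≤ H₁)
    (hsr : ∀ k : K, ∀ v : Fin m → ZMod p, v ≠ 0 → k • v = v → k = 1) :
    (Nat.card H₃ + (Nat.card H₂ - 1)) * Nat.card H₁ +
        Nat.card K * (Nat.card (ℙ (ZMod p) (Fin m → ZMod p)) - 1) ≤
      (p - 1) * Nat.card (ℙ (ZMod p) (Fin m → ZMod p)) ^ 2 := by
  obtain ⟨f, hf, h1, h0⟩ := exists_test hdes
  exact law_left hm htpp hf h1 h0 hK hsr

end Crux

/-! ## A verdict the Neumann counts cannot give: `(m, p) = (3, 11)`, both ends semiregular -/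

/-- The cubic bound behind the verdict: `176890 u ≤ 23473702 + u³ + 131 u²` for `u ≥ 0`
(the left side minus `u³ + 131 u²` peaks at `u = 203` with value `22 144 864`). -/
theorem cubic_bound (u : ℤ) (hu : 0 ≤ u) : 176890 * u ≤ 23473702 + u ^ 3 + 131 * u ^ 2 := by
  nlinarith [mul_nonneg (sq_nonneg (u - 203)) (by linarith : (0 : ℤ) ≤ u + 536),
    sq_nonneg (2 * u - 483)]

/-- The arithmetic core: `z (x + w + 132) ≤ 176890`, `x ≤ z` and `x (w + 1) z ≥ 23 473 703` are
incompatible (`w = y − 1`; `xyz ≤ 176890 x − x³ − 131 x² ≤ 23 473 702`). -/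
theorem arith_core {x w z : ℤ} (hx : 1 ≤ x) (hxz : x ≤ z)
    (hR : (x + w) * z + z * 132 ≤ 176890) (hV : 23473703 ≤ x * (w + 1) * z) : False := by
  have k := cubic_bound x (by linarith)
  have h2 : x * x ≤ x * z := mul_le_mul_of_nonneg_left hxz (by linarith)
  have h2' : x * x * x ≤ x * x * z := mul_le_mul_of_nonneg_left hxz (by positivity)
  have h3 : x * ((x + w) * z + z * 132) ≤ x * 176890 := mul_le_mul_of_nonneg_left hR (by linarith)
  nlinarith [k, h2, h2', h3, hV]

/-- `b = #ℙ²(𝔽_11) = 133`. -/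
theorem card_proj_3_11 [Fact (Nat.Prime 11)] : Nat.card (ℙ (ZMod 11) (Fin 3 → ZMod 11)) = 133 := by
  have h := LevelOneDim.card_proj_mul (p := 11) (m := 3)
  norm_num at h
  omega

/-- **NO BI-SEMIREGULAR LEVEL-ONE WITNESS AT `(m, p) = (3, 11)`** for any `−2 < ε ≤ 1`: a subgroup
TPP triple of `GL_3(𝔽_11)` with a level-one identity design beating the budget at exponent `2 + ε`
cannot have both end members `H₁`, `H₃` semiregular on `𝔽_11³ ∖ 0`.  (Not implied by the Neumann
squeeze, which at `p = 11` stops at `ε ≈ 0.684`.) -/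
theorem no_biSemiregular_3_11 [Fact (Nat.Prime 11)] {ε : ℝ} (hε : -2 < ε) (hε1 : ε ≤ 1)
    {H₁ H₂ H₃ : Subgroup (GLm 11 3)} (htpp : SubgroupTPP H₁ H₂ H₃)
    (hdes : ∃ c : Mat 11 3 → ℂ, (∀ M, 1 < M.rank → c M = 0) ∧
      (∑ M, c M * ZMod.stdAddChar (Matrix.trace (M * ((1 : GLm 11 3) : Mat 11 3)))) = 1 ∧
      ∀ a ∈ H₁, ∀ b ∈ H₂, ∀ g ∈ H₃, a * b * g ≠ 1 →
        (∑ M, c M * ZMod.stdAddChar (Matrix.trace (M * ((a * b * g : GLm 11 3) : Mat 11 3)))) = 0)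
    (hlt : budget 11 3 1 (2 + ε) <
      ((Nat.card H₁ * Nat.card H₂ * Nat.card H₃ : ℕ) : ℝ) ^ ((2 + ε) / 3))
    (hsr₁ : ∀ k : H₁, ∀ v : Fin 3 → ZMod 11, v ≠ 0 → k • v = v → k = 1)
    (hsr₃ : ∀ k : H₃, ∀ v : Fin 3 → ZMod 11, v ≠ 0 → k • v = v → k = 1) : False := by
  obtain ⟨f, hf, h1, h0⟩ := exists_test hdes
  have hm : 1 ≤ 3 := by norm_num
  have hR := law_right hm htpp hf h1 h0 le_rfl hsr₃
  have hL := law_left hm htpp hf h1 h0 le_rfl hsr₁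
  have hfl := LevelOneFloorAll.volume_gt_floor_nat (p := 11) (l := 2) (by norm_num) hε hε1 hlt
  clear hlt hdes hf h0
  rw [card_proj_3_11] at hR hL
  have hx1 : 1 ≤ Nat.card H₁ := Nat.card_pos
  have hy1 : 1 ≤ Nat.card H₂ := Nat.card_pos
  have hz1 : 1 ≤ Nat.card H₃ := Nat.card_pos
  set x := Nat.card H₁
  set y := Nat.card H₂
  set z := Nat.card H₃
  clear_value x y z
  norm_num at hR hL hfl
  obtain ⟨w, rfl⟩ : ∃ w, y = w + 1 := ⟨y - 1, by omega⟩
  rw [Nat.add_sub_cancel] at hR hL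
  have hV : 23473703 ≤ x * (w + 1) * z := by omega
  rcases le_total x z with hxz | hzx
  · exact arith_core (x := x) (w := w) (z := z) (by exact_mod_cast hx1) (by exact_mod_cast hxz)
      (by exact_mod_cast hR) (by exact_mod_cast hV)
  · have hV' : 23473703 ≤ z * (w + 1) * x := by
      rw [show z * (w + 1) * x = x * (w + 1) * z by ring]; exact hV
    exact arith_core (x := z) (w := w) (z := x) (by exact_mod_cast hz1) (by exact_mod_cast hzx)
      (by exact_mod_cast hL) (by exact_mod_cast hV')

end SemiregularLaw
end Summit.MatrixMultiplication.MatrixMultiplication.Theorems.SubgroupIdentityDesigns.Negative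

end
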